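import Literature.MathematicalPhysics.QuantumFieldTheory.BalabanImbrieJaffe1984to88.BIJ88Ineq247Walks

/-!
# `BalabanImbrieJaffe1984to88.BIJ88Decay241Walks` — T. Bałaban, J. Imbrie, A. Jaffe, *Effective action and cluster properties of
the abelian Higgs model*, Commun. Math. Phys. **114** (1988) 257–315 [BalabanImbrieJaffe1988]: Sect. 2 p. 264, **(2.41)**
`|C^{(k)}_Λ(u;x₁,x₂)| ≦ ce^{−c|x₁−x₂|}` *"by … a random walk expansion as in [6]"* and *"The local part C^{(k)}_{Λ,loc} … is bounded as
in (2.41)"* PROVED in the setting of [6] = [Balaban1983RegularityDecay] made explicit by p36's `BIJ88Ineq246Walks`/`BIJ88Ineq247Walks`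
(«model instance»), with the two constants explicit

statement-level skeleton of published theorems with citation tags; proofs where landed; nothing here is a claim about the Yang–Mills mass gap

PDF held: `paper:balaban1988-cmp114-bij-abelian-higgs-effective-action` (journal page = PDF page + 256); p. 264 [PDF 8] read this session from
the text layer (`lit read … --pages 7-9`).

WHAT IS REPRODUCED.  SKELETON row **C2.Eq2.41** (+ the p. 264 sentence of rows C2.Eq2.43/2.48 *"bounded as in (2.41)"*) (cell `lit-balaban`,
HOME `run/shared/lean/pub/lit-balaban/`; Phase-2 seat p02 gen 3 = unit `lit-balaban-p02`; C2 §§1–4 fold owner r18, referee ref-5; walk-model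
carriers by p13 (`BIJ88RandomWalk242`) and p36 (`BIJ88WalkGeometry246`, `BIJ88Ineq246Walks`, `BIJ88Ineq247Walks`, `BIJ88WalkGeometryZd`),
nothing restated; TAKING line HOME/STATUS.md 2026-08-21T04:39:33Z).  Before this file (2.41) was the bare `def … : Prop`
`BIJ88Sect2Statements.Decay` (typed p239939).
p. 264, verbatim: *"We define C^{(k)}_Λ(u) = [(Δ_{k,loc}(u) + aL^{−2}Q(u)*Q(u))|_Λ]^{−1}. (2.40) This is of course a nonlocal operator, but by
(2.38), C^{(k)}_Λ(u)^{−1} is bounded below and a random walk expansion as in [6] can be used to prove that |C^{(k)}_Λ(u;x₁,x₂)| ≦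
ce^{−c|x₁−x₂|}. (2.41) We shall actually use a convenient resummation of this expansion. The basic expansion has the form C^{(k)}_Λ(u) =
Σ_ω C_ω, (2.42) … The local part C^{(k)}_{Λ,loc}(u;x₁,x₂) depends only on u in an O(r(e_k)) neighborhood of x₁,x₂; it vanishes for |x₁ − x₂| >
½r(e_k) and is bounded as in (2.41)."*

WHAT IS PROVED HERE (0 `sorry`, standard axioms; theorems only).  In [6]'s setting as typed by p36 (walk kernels `C_ω(x₁,x₂)` majorized
by `Aβⁿ`, vanishing unless `ω` is a nearest-neighbour walk from a block of x₁ to a block of x₂; out-degree `≤ D`, `Dβ ≤ e^{−δ}`; at most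
`s₀` blocks per site; label distance `d`, site–label distance `ldist` `μ`-Lipschitz along `d`, blocks of `ldist`-radius `b₀`; site distance
dominated through any label), for ANY `C` with (2.42) `Eq242 C C_ω`:
**`abs_C_le_exp`**: `|C(x₁,x₂)| ≤ (s₀A/(1 − Dβ))·e^{2δb₀/μ}·e^{−(δ/μ)|x₁−x₂|}` (all walks = one class; a contributing walk has length
`≥ (|x₁−x₂| − 2b₀)/μ` by p36's `sdist_le_of_blocks`; the class sums to a geometric tail by p36's `abs_tsum_walks_le_exp`);
**`abs_cLoc_le_exp`**: the same bound for the local part `BIJ88RandomWalk242.cLoc` (*"bounded as in (2.41)"*);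
`decay241` / `decay241_cLoc`: the typed one-letter `BIJ88Sect2Statements.Decay |·−·| C c` under the explicit compatibility
`(s₀A/(1−Dβ))e^{2δb₀/μ} ≤ c ≤ δ/μ` (prefactor ≤ c ≤ rate — print's generic c conflates the two; cf. HOME/GAPS.md G-C2-p02-02);
§2 the `ℤ^d` instances `abs_C_le_exp_Zd`, `abs_cLoc_le_exp_Zd` with the geometry of `BIJ88WalkGeometryZd` discharged (labels `pos : ι ↪ ℤ^d`,
[6]'s `cubeAdj`, `D = 3^d`, `s₀ = (2t+1)^d`, `μ = M′`, `b₀ = M′t`, sup-distance of sites).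
HONEST SCOPE.  What remains of [6] are its analytic hypotheses exactly as in p36's files (the majorant `Aβⁿ` with end-point locality = [6] Lemma
2.1 for the actual `C^{(k)}_Λ(u)` of (2.40), i.e. the L²-bounds behind it and the lower bound (2.38)) — displayed hypotheses `hmaj`/`hnz`/`hθ`;
nothing on d = 4 or the continuum; NOT summit progress.
-/

namespace Literature.MathematicalPhysics.QuantumFieldTheory.BalabanImbrieJaffe1984to88.BIJ88Decay241Walks

open Finset
open Literature.MathematicalPhysics.QuantumFieldTheory.Balaban1983to89.B4RandomWalk213
open BIJ88RandomWalk242 BIJ88WalkGeometry246 BIJ88Ineq246Walks BIJ88Ineq247Walks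

variable {ι α : Type*} [Fintype ι] [DecidableEq ι]

/-! ## §1 (2.41) in the setting of [6] -/

omit [Fintype ι] [DecidableEq ι] in
/-- By (2.42), `C(x₁,x₂)` is the sum over the class of ALL walks. [cite: BalabanImbrieJaffe1988, (2.42) p.264] -/
theorem eq_tsum_univ (Cw : Walk ι → α → α → ℝ) {C : α → α → ℝ} (hC : Eq242 C Cw) (x₁ x₂ : α) :
    C x₁ x₂ = ∑' ω, (Set.univ : Set (Walk ι)).indicator (fun ω => Cw ω x₁ x₂) ω := by
  rw [Set.indicator_univ]
  exact ((hC x₁ x₂).tsum_eq).symm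

/-- **(2.41) PROVED IN THE SETTING OF [6]** («model instance», two explicit constants): for any `C` with the walk expansion (2.42)
and walk kernels majorized by `Aβⁿ` with end-point locality, `|C(x₁,x₂)| ≤ (s₀A/(1 − Dβ))·e^{2δb₀/μ}·e^{−(δ/μ)|x₁−x₂|}` — a contributing
walk joins a block of x₁ to a block of x₂, hence has length `≥ (|x₁−x₂| − 2b₀)/μ`, and the walks sum to a geometric tail.
[cite: BalabanImbrieJaffe1988, (2.41) p.264] -/
theorem abs_C_le_exp (adj : ι → ι → Prop) [DecidableRel adj] (ldist : ι → α → ℝ)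
    (Cw : Walk ι → α → α → ℝ) {C : α → α → ℝ} (hC : Eq242 C Cw) (inBlock : α → ι → Prop)
    (d : ι → ι → ℝ) (hd0 : ∀ i, d i i = 0) (hdsymm : ∀ i l, d i l = d l i)
    (htri : ∀ i j l, d i l ≤ d i j + d j l) (hadj : ∀ i l, adj i l → d i l ≤ 1)
    {μ b₀ : ℝ} (hμ : 0 < μ) (hld : ∀ (i l : ι) (x : α), ldist l x ≤ ldist i x + μ * d i l)
    (hb : ∀ (x : α) (i : ι), inBlock x i → ldist i x ≤ b₀)
    (sd : α → α → ℝ) (hsd : ∀ (i : ι) (x₁ x₂ : α), sd x₁ x₂ ≤ ldist i x₁ + ldist i x₂)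
    {A β δ : ℝ} {D s₀ : ℕ} (hA : 0 ≤ A) (hβ0 : 0 ≤ β)
    (hD : ∀ j, (Finset.univ.filter fun i => adj j i).card ≤ D) (hδ : 0 < δ) (hθ : (D : ℝ) * β ≤ Real.exp (-δ))
    (hmaj : ∀ ω x₁ x₂, |Cw ω x₁ x₂| ≤ A * β ^ ω.len)
    (hnz : ∀ ω x₁ x₂, Cw ω x₁ x₂ ≠ 0 → ω.IsNN adj ∧ inBlock x₁ ω.start ∧ inBlock x₂ ω.last)
    (hS₀ : ∀ x, ∃ S₀ : Finset ι, S₀.card ≤ s₀ ∧ ∀ i, inBlock x i → i ∈ S₀) (x₁ x₂ : α) :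
    |C x₁ x₂| ≤ s₀ * A / (1 - D * β) * Real.exp (2 * δ * b₀ / μ) * Real.exp (-(δ / μ) * sd x₁ x₂) := by
  set L : ℝ := (sd x₁ x₂ - 2 * b₀) / μ with hL
  have hlen : ∀ ω ∈ (Set.univ : Set (Walk ι)), Cw ω x₁ x₂ ≠ 0 → L ≤ ω.len := by
    intro ω _ hz
    obtain ⟨hnn, h1, h2⟩ := hnz ω x₁ x₂ hz
    have hb' := sdist_le_of_blocks adj ldist inBlock d hd0 hdsymm htri hadj hμ hld hb sd hsd ω hnn h1 h2
    rw [hL, div_le_iff₀ hμ]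
    linarith
  have hbound := abs_tsum_walks_le_exp adj Cw inBlock hA hβ0 hD hδ hθ hmaj hnz hS₀ Set.univ x₁ x₂ L hlen
  rw [eq_tsum_univ Cw hC x₁ x₂]
  refine hbound.trans (le_of_eq ?_)
  rw [hL, mul_assoc, ← Real.exp_add]
  congr 1
  congr 1
  field_simp
  ring

/-- *"The local part C^{(k)}_{Λ,loc}(u;x₁,x₂) … is bounded as in (2.41)"* (p. 264): the same bound for p13's `cLoc` (the primed
sub-sum (2.43)), same mechanism. [cite: BalabanImbrieJaffe1988, (2.43) p.264] -/
theorem abs_cLoc_le_exp (adj : ι → ι → Prop) [DecidableRel adj] (ldist : ι → α → ℝ) (ρ : ℝ)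
    (Cw : Walk ι → α → α → ℝ) (inBlock : α → ι → Prop)
    (d : ι → ι → ℝ) (hd0 : ∀ i, d i i = 0) (hdsymm : ∀ i l, d i l = d l i)
    (htri : ∀ i j l, d i l ≤ d i j + d j l) (hadj : ∀ i l, adj i l → d i l ≤ 1)
    {μ b₀ : ℝ} (hμ : 0 < μ) (hld : ∀ (i l : ι) (x : α), ldist l x ≤ ldist i x + μ * d i l)
    (hb : ∀ (x : α) (i : ι), inBlock x i → ldist i x ≤ b₀)
    (sd : α → α → ℝ) (hsd : ∀ (i : ι) (x₁ x₂ : α), sd x₁ x₂ ≤ ldist i x₁ + ldist i x₂)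
    {A β δ : ℝ} {D s₀ : ℕ} (hA : 0 ≤ A) (hβ0 : 0 ≤ β)
    (hD : ∀ j, (Finset.univ.filter fun i => adj j i).card ≤ D) (hδ : 0 < δ) (hθ : (D : ℝ) * β ≤ Real.exp (-δ))
    (hmaj : ∀ ω x₁ x₂, |Cw ω x₁ x₂| ≤ A * β ^ ω.len)
    (hnz : ∀ ω x₁ x₂, Cw ω x₁ x₂ ≠ 0 → ω.IsNN adj ∧ inBlock x₁ ω.start ∧ inBlock x₂ ω.last)
    (hS₀ : ∀ x, ∃ S₀ : Finset ι, S₀.card ≤ s₀ ∧ ∀ i, inBlock x i → i ∈ S₀) (x₁ x₂ : α) :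
    |cLoc ldist ρ Cw x₁ x₂| ≤ s₀ * A / (1 - D * β) * Real.exp (2 * δ * b₀ / μ) * Real.exp (-(δ / μ) * sd x₁ x₂) := by
  set L : ℝ := (sd x₁ x₂ - 2 * b₀) / μ with hL
  have hlen : ∀ ω ∈ {ω : Walk ι | Near ldist ρ ω x₁ x₂}, Cw ω x₁ x₂ ≠ 0 → L ≤ ω.len := by
    intro ω _ hz
    obtain ⟨hnn, h1, h2⟩ := hnz ω x₁ x₂ hz
    have hb' := sdist_le_of_blocks adj ldist inBlock d hd0 hdsymm htri hadj hμ hld hb sd hsd ω hnn h1 h2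
    rw [hL, div_le_iff₀ hμ]
    linarith
  have hbound := abs_tsum_walks_le_exp adj Cw inBlock hA hβ0 hD hδ hθ hmaj hnz hS₀
    {ω : Walk ι | Near ldist ρ ω x₁ x₂} x₁ x₂ L hlen
  unfold cLoc
  refine hbound.trans (le_of_eq ?_)
  rw [hL, mul_assoc, ← Real.exp_add]
  congr 1
  congr 1
  field_simp
  ring

/-- **(2.41), THE TYPED ROW** `BIJ88Sect2Statements.Decay |·−·| C c` in print's one-letter shape, for any `c` between the prefactor and the
rate: `(s₀A/(1−Dβ))e^{2δb₀/μ} ≤ c ≤ δ/μ` (the generic c of (2.41) conflates the two; the two-constant form is `abs_C_le_exp`).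
[cite: BalabanImbrieJaffe1988, (2.41) p.264] -/
theorem decay241 (adj : ι → ι → Prop) [DecidableRel adj] (ldist : ι → α → ℝ)
    (Cw : Walk ι → α → α → ℝ) {C : α → α → ℝ} (hC : Eq242 C Cw) (inBlock : α → ι → Prop)
    (d : ι → ι → ℝ) (hd0 : ∀ i, d i i = 0) (hdsymm : ∀ i l, d i l = d l i)
    (htri : ∀ i j l, d i l ≤ d i j + d j l) (hadj : ∀ i l, adj i l → d i l ≤ 1)
    {μ b₀ : ℝ} (hμ : 0 < μ) (hld : ∀ (i l : ι) (x : α), ldist l x ≤ ldist i x + μ * d i l)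
    (hb : ∀ (x : α) (i : ι), inBlock x i → ldist i x ≤ b₀)
    (sd : α → α → ℝ) (hsd0 : ∀ x₁ x₂, 0 ≤ sd x₁ x₂) (hsd : ∀ (i : ι) (x₁ x₂ : α), sd x₁ x₂ ≤ ldist i x₁ + ldist i x₂)
    {A β δ : ℝ} {D s₀ : ℕ} (hA : 0 ≤ A) (hβ0 : 0 ≤ β)
    (hD : ∀ j, (Finset.univ.filter fun i => adj j i).card ≤ D) (hδ : 0 < δ) (hθ : (D : ℝ) * β ≤ Real.exp (-δ))
    (hmaj : ∀ ω x₁ x₂, |Cw ω x₁ x₂| ≤ A * β ^ ω.len)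
    (hnz : ∀ ω x₁ x₂, Cw ω x₁ x₂ ≠ 0 → ω.IsNN adj ∧ inBlock x₁ ω.start ∧ inBlock x₂ ω.last)
    (hS₀ : ∀ x, ∃ S₀ : Finset ι, S₀.card ≤ s₀ ∧ ∀ i, inBlock x i → i ∈ S₀)
    {c : ℝ} (hKc : s₀ * A / (1 - D * β) * Real.exp (2 * δ * b₀ / μ) ≤ c) (hcμ : c ≤ δ / μ) :
    BIJ88Sect2Statements.Decay sd C c := by
  intro x₁ x₂
  refine (abs_C_le_exp adj ldist Cw hC inBlock d hd0 hdsymm htri hadj hμ hld hb sd hsd hA hβ0 hD hδ hθ hmaj hnz hS₀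
    x₁ x₂).trans ?_
  have hK0 : 0 ≤ s₀ * A / (1 - (D : ℝ) * β) * Real.exp (2 * δ * b₀ / μ) := by
    have he1 : Real.exp (-δ) < 1 := Real.exp_lt_one_iff.mpr (neg_lt_zero.mpr hδ)
    have h1 : 0 ≤ s₀ * A / (1 - (D : ℝ) * β) :=
      div_nonneg (mul_nonneg (Nat.cast_nonneg _) hA) (by linarith [hθ.trans_lt he1])
    exact mul_nonneg h1 (Real.exp_pos _).le
  refine mul_le_mul hKc ?_ (Real.exp_pos _).le (hK0.trans hKc)
  rw [Real.exp_le_exp]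
  nlinarith [mul_le_mul_of_nonneg_right hcμ (hsd0 x₁ x₂)]

/-- The typed one-letter `Decay` for the local part, same compatibility. [cite: BalabanImbrieJaffe1988, (2.43) p.264] -/
theorem decay241_cLoc (adj : ι → ι → Prop) [DecidableRel adj] (ldist : ι → α → ℝ) (ρ : ℝ)
    (Cw : Walk ι → α → α → ℝ) (inBlock : α → ι → Prop)
    (d : ι → ι → ℝ) (hd0 : ∀ i, d i i = 0) (hdsymm : ∀ i l, d i l = d l i)
    (htri : ∀ i j l, d i l ≤ d i j + d j l) (hadj : ∀ i l, adj i l → d i l ≤ 1)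
    {μ b₀ : ℝ} (hμ : 0 < μ) (hld : ∀ (i l : ι) (x : α), ldist l x ≤ ldist i x + μ * d i l)
    (hb : ∀ (x : α) (i : ι), inBlock x i → ldist i x ≤ b₀)
    (sd : α → α → ℝ) (hsd0 : ∀ x₁ x₂, 0 ≤ sd x₁ x₂) (hsd : ∀ (i : ι) (x₁ x₂ : α), sd x₁ x₂ ≤ ldist i x₁ + ldist i x₂)
    {A β δ : ℝ} {D s₀ : ℕ} (hA : 0 ≤ A) (hβ0 : 0 ≤ β)
    (hD : ∀ j, (Finset.univ.filter fun i => adj j i).card ≤ D) (hδ : 0 < δ) (hθ : (D : ℝ) * β ≤ Real.exp (-δ))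
    (hmaj : ∀ ω x₁ x₂, |Cw ω x₁ x₂| ≤ A * β ^ ω.len)
    (hnz : ∀ ω x₁ x₂, Cw ω x₁ x₂ ≠ 0 → ω.IsNN adj ∧ inBlock x₁ ω.start ∧ inBlock x₂ ω.last)
    (hS₀ : ∀ x, ∃ S₀ : Finset ι, S₀.card ≤ s₀ ∧ ∀ i, inBlock x i → i ∈ S₀)
    {c : ℝ} (hKc : s₀ * A / (1 - D * β) * Real.exp (2 * δ * b₀ / μ) ≤ c) (hcμ : c ≤ δ / μ) :
    BIJ88Sect2Statements.Decay sd (cLoc ldist ρ Cw) c := by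
  intro x₁ x₂
  refine (abs_cLoc_le_exp adj ldist ρ Cw inBlock d hd0 hdsymm htri hadj hμ hld hb sd hsd hA hβ0 hD hδ hθ hmaj hnz hS₀
    x₁ x₂).trans ?_
  have hK0 : 0 ≤ s₀ * A / (1 - (D : ℝ) * β) * Real.exp (2 * δ * b₀ / μ) := by
    have he1 : Real.exp (-δ) < 1 := Real.exp_lt_one_iff.mpr (neg_lt_zero.mpr hδ)
    have h1 : 0 ≤ s₀ * A / (1 - (D : ℝ) * β) :=
      div_nonneg (mul_nonneg (Nat.cast_nonneg _) hA) (by linarith [hθ.trans_lt he1])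
    exact mul_nonneg h1 (Real.exp_pos _).le
  refine mul_le_mul hKc ?_ (Real.exp_pos _).le (hK0.trans hKc)
  rw [Real.exp_le_exp]
  nlinarith [mul_le_mul_of_nonneg_right hcμ (hsd0 x₁ x₂)]

/-! ## §2 The instances on `ℤ^d` (geometry of `BIJ88WalkGeometryZd` discharged) -/

section Zd

open BIJ88WalkGeometryZd

variable {dd : ℕ}

/-- **(2.41) ON `ℤ^d`** («model instance»): labels `pos : ι ↪ ℤ^d` of the M-cubes with [6]'s adjacency `cubeAdj`, sites `x ∈ ℤ^d` at `M′`
sites per label unit, blocks = labels within `M′t` of a site, sup-distance of sites; ANALYTIC HYPOTHESES as in [6]: walk kernels majorized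
by `Aβⁿ`, vanishing unless the walk is nearest-neighbour from a block of x₁ to a block of x₂, `3^dβ ≤ e^{−δ}`; for any `C` with (2.42):
`|C(x₁,x₂)| ≤ ((2t+1)^d A/(1 − 3^dβ))·e^{2δt}·e^{−(δ/M′)|x₁−x₂|_∞}`. [cite: BalabanImbrieJaffe1988, (2.41) p.264] -/
theorem abs_C_le_exp_Zd (pos : ι → Fin dd → ℤ) (hpos : Function.Injective pos) {M' : ℕ} (hM' : 0 < M') (t : ℕ)
    (Cw : Walk ι → (Fin dd → ℤ) → (Fin dd → ℤ) → ℝ) {C : (Fin dd → ℤ) → (Fin dd → ℤ) → ℝ} (hC : Eq242 C Cw)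
    {A β δ : ℝ} (hA : 0 ≤ A) (hβ0 : 0 ≤ β) (hδ : 0 < δ) (hθ : ((3 ^ dd : ℕ) : ℝ) * β ≤ Real.exp (-δ))
    (hmaj : ∀ ω x₁ x₂, |Cw ω x₁ x₂| ≤ A * β ^ ω.len)
    (hnz : ∀ ω x₁ x₂, Cw ω x₁ x₂ ≠ 0 → ω.IsNN (cubeAdj pos) ∧
      ldistZ M' pos ω.start x₁ ≤ (M' : ℝ) * t ∧ ldistZ M' pos ω.last x₂ ≤ (M' : ℝ) * t)
    (x₁ x₂ : Fin dd → ℤ) :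
    |C x₁ x₂| ≤ ((2 * t + 1) ^ dd : ℕ) * A / (1 - ((3 ^ dd : ℕ) : ℝ) * β) * Real.exp (2 * δ * ((M' : ℝ) * t) / M')
      * Real.exp (-(δ / M') * supDist x₁ x₂) :=
  abs_C_le_exp (cubeAdj pos) (fun j x => ldistZ M' pos j x) Cw hC (fun x j => ldistZ M' pos j x ≤ (M' : ℝ) * t)
    (fun i l => supDist (pos i) (pos l)) (fun i => supDist_self _) (fun i l => supDist_comm _ _)
    (fun i j l => supDist_triangle _ _ _) (fun i l h => supDist_le_one_of_cubeAdj pos h) (by exact_mod_cast hM')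
    (fun i l x => ldistZ_le M' pos i l x) (fun x i h => h) supDist (fun i x₁ x₂ => supDist_le_ldistZ M' pos i x₁ x₂)
    hA hβ0 (card_cubeAdj_le pos hpos) hδ hθ hmaj hnz (fun x => exists_blocks hM' t pos hpos x) x₁ x₂

/-- *"bounded as in (2.41)"* ON `ℤ^d` for the local part `cLoc`. [cite: BalabanImbrieJaffe1988, (2.43) p.264] -/
theorem abs_cLoc_le_exp_Zd (pos : ι → Fin dd → ℤ) (hpos : Function.Injective pos) {M' : ℕ} (hM' : 0 < M') (t : ℕ) (ρ : ℝ)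
    (Cw : Walk ι → (Fin dd → ℤ) → (Fin dd → ℤ) → ℝ)
    {A β δ : ℝ} (hA : 0 ≤ A) (hβ0 : 0 ≤ β) (hδ : 0 < δ) (hθ : ((3 ^ dd : ℕ) : ℝ) * β ≤ Real.exp (-δ))
    (hmaj : ∀ ω x₁ x₂, |Cw ω x₁ x₂| ≤ A * β ^ ω.len)
    (hnz : ∀ ω x₁ x₂, Cw ω x₁ x₂ ≠ 0 → ω.IsNN (cubeAdj pos) ∧
      ldistZ M' pos ω.start x₁ ≤ (M' : ℝ) * t ∧ ldistZ M' pos ω.last x₂ ≤ (M' : ℝ) * t)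
    (x₁ x₂ : Fin dd → ℤ) :
    |cLoc (fun j x => ldistZ M' pos j x) ρ Cw x₁ x₂|
      ≤ ((2 * t + 1) ^ dd : ℕ) * A / (1 - ((3 ^ dd : ℕ) : ℝ) * β) * Real.exp (2 * δ * ((M' : ℝ) * t) / M')
        * Real.exp (-(δ / M') * supDist x₁ x₂) :=
  abs_cLoc_le_exp (cubeAdj pos) (fun j x => ldistZ M' pos j x) ρ Cw (fun x j => ldistZ M' pos j x ≤ (M' : ℝ) * t)
    (fun i l => supDist (pos i) (pos l)) (fun i => supDist_self _) (fun i l => supDist_comm _ _)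
    (fun i j l => supDist_triangle _ _ _) (fun i l h => supDist_le_one_of_cubeAdj pos h) (by exact_mod_cast hM')
    (fun i l x => ldistZ_le M' pos i l x) (fun x i h => h) supDist (fun i x₁ x₂ => supDist_le_ldistZ M' pos i x₁ x₂)
    hA hβ0 (card_cubeAdj_le pos hpos) hδ hθ hmaj hnz (fun x => exists_blocks hM' t pos hpos x) x₁ x₂

end Zd

end Literature.MathematicalPhysics.QuantumFieldTheory.BalabanImbrieJaffe1984to88.BIJ88Decay241Walks
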